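import Literature.AlgebraicGeometry.Resolution.AlterationsNormalizationReduction
import Literature.AlgebraicGeometry.Resolution.AlterationsDescent
import HarnessLib

/-!
# De Jong's alteration theorem: `DeJong1996NormalProjectiveReduction` (4.6–4.10) discharged

Topic: `Literature/AlgebraicGeometry/Resolution`. Fourth layer under `AlterationsInduction.lean`
(the induction step of de Jong 1996, Thm. 4.1, split at 4.10 into the reduction to normal
projective pairs `DeJong1996NormalProjectiveReduction`, 4.6–4.10, and the step
`DeJong1996NormalProjectiveStep`, 4.11–4.28). The layers `AlterationsCompactification.lean`
(4.6–4.7 proved), `AlterationsBlowupDivisor.lean` (4.8 proved GIVEN the projectivity of blow-ups,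
`BlowupProjectiveOverField` = Hartshorne II.7.16 (c)) and `AlterationsNormalizationReduction.lean`
(4.10 proved) leave `DeJong1996NormalProjectiveReduction` depending on the named fact
`BlowupProjectiveOverField`. This file removes that dependency and proves
`DeJong1996NormalProjectiveReduction_holds` UNCONDITIONALLY.

The point (de Jong 1996, 4.10: "(iii) holds as long as we only take projective alterations"):
the printed proof needs the blow-up `X' → X` of 4.8 only as SOME generically étale alteration
under which `Z` becomes the support of a divisor and whose source is again projective. Instead
of the projectivity of `X'` itself we use that `X'` is proper over `k` (blow-ups of Noetherian
schemes are proper, Stacks 02NS = `IsBlowup.isProper`, proved in this topic) and apply the tree's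
proved Chow lemma (`ChowLemmaIntegral_holds`, Görtz–Wedhorn I, Thm. 13.100) once more: a proper
variety admits a projective modification `X'' → X'` (`DeJong1996.exists_projective_modification`:
an immersion into `ℙⁿ_k` of a proper `k`-scheme is a closed immersion), along which the
exceptional divisor pulls back to an effective Cartier divisor with support the preimage of `Z`
(`IsEffectiveCartier.comap_of_isDominant`, 4.10, proved in `AlterationsNormalizationReduction.lean`),
the dimension being unchanged (2.20, `IsAlteration.topologicalKrullDim_eq`) and 4.4 applying
(`DeJong1996.ConclusionGenericallyEtale.of_isAlteration`).

## Content

* `DeJong1996.exists_projective_modification` — a proper variety over a field has a generically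
  étale alteration (a modification) from a projective variety.
* `DeJong1996.conclusionGenericallyEtale_of_divisor'` — 4.8 without `BlowupProjectiveOverField`.
* `DeJong1996NormalProjectiveReduction_holds` — DISCHARGE of the named fact of
  `AlterationsInduction.lean` (4.6–4.10).
* Assembly: `DeJong1996InductionStep.of_step`, `DeJong1996StrongAlgClosed.of_step`,
  `DeJong1996Strong.of_descent_of_step`, `DeJong1996StrongPerfect.of_descent_of_step`,
  `DeJong1996Projective.of_descent_of_step`, and with the proved part of 4.5
  (`AlterationsDescent.lean`) `DeJong1996Strong.of_finiteSubextension45_of_step`,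
  `DeJong1996Projective.of_finiteSubextension45_of_step`. The live nodes of the DAG of Thm. 4.1
  (i)/(ii) are now `DeJong1996.FiniteSubextension45` (the limit argument of 4.5) and
  `DeJong1996NormalProjectiveStep` (4.11–4.28).

## Sources

* A. J. de Jong, *Smoothness, semi-stability and alterations*, Publ. Math. IHÉS 83 (1996) 51–93:
  4.4, 4.6–4.8, 4.10 (pp. 66–67).
* U. Görtz, T. Wedhorn, *Algebraic Geometry I*, 2nd ed. (2020), Thm. 13.100 (Chow's lemma).
* The Stacks Project, Tags 02NS, 02ND, 02OS (blowing up).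
-/

noncomputable section

open CategoryTheory AlgebraicGeometry TopologicalSpace Topology

namespace Literature.AlgebraicGeometry.Resolution

universe u

namespace DeJong1996

/-! ## Chow's lemma for proper varieties: a projective modification -/

/-- **A proper variety admits a projective modification** (Chow's lemma, Görtz–Wedhorn I,
Thm. 13.100, in the tree's proved form `ChowLemmaIntegral_holds`, combined with: an immersion
`X' ↪ ℙⁿ_k` of a proper `k`-scheme is proper, hence a closed immersion): for `X` integral and
proper over `k` there are an integral `X'` and a generically étale alteration (indeed a
modification) `π : X' → X` with `X'` projective over `k` via `π ≫ f`.
[cite: GortzWedhorn2020, Thm 13.100] -/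
theorem exists_projective_modification {k : Type u} [Field k] (X : Scheme.{u})
    (f : X ⟶ Spec (.of k)) [IsProper f] [IsIntegral X] :
    ∃ (X' : Scheme.{u}) (π : X' ⟶ X), IsIntegral X' ∧ IsAlteration π ∧ IsGenericallyEtale π ∧
      Literature.AlgebraicGeometry.Motives.IsProjectiveOver (Over.mk (π ≫ f)) := by
  obtain ⟨n, X', π, ι, hint, himm, hprop, hsurj, hover, U, hUd, hU'd, hiso⟩ :=
    ChowLemmaIntegral_holds k X f inferInstance inferInstance inferInstance ‹_›
  haveI := hint
  haveI := himm
  haveI := hprop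
  haveI := hsurj
  haveI := hiso
  haveI : IsProper (Motives.projectiveSpace n k).hom := Motives.isProper_projectiveSpace n k
  haveI : IsProper (ι ≫ (Motives.projectiveSpace n k).hom) := by
    rw [hover]
    infer_instance
  haveI : IsProper ι := IsProper.of_comp ι (Motives.projectiveSpace n k).hom
  have hcl : IsClosedImmersion ι := .of_isPreimmersion ι ι.isClosedMap.isClosed_range
  exact ⟨X', π, inferInstance,
    ⟨inferInstance, inferInstance, inferInstance, U, hUd.nonempty, inferInstance⟩,
    IsGenericallyEtale.of_isIso_morphismRestrict π U hU'd, n, Over.homMk ι hover, hcl⟩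

/-! ## 4.8 without the projectivity of blow-ups -/

/-- **de Jong 1996, 4.8, unconditionally**: over a field `k`, Thm. 4.1 with its
generically-étale clause for a proper (e.g. projective) variety `X` and a proper closed `Z ⊂ X`
follows from the same statement for all pairs `(X'', Z'')` over `k` with `X''` a PROJECTIVE
variety of the same dimension as `X` and `Z'' ⊂ X''` a proper closed subset which is the support
of an effective Cartier divisor. Printed: "Let `φ : X' → X` be the blowing up in the ideal sheaf
of `Z` [...] Thus `φ` is a modification of `X`. Note that `Z' = φ⁻¹(Z)` is the reduction of a
divisor `D' ⊂ X'` (see 2.3). We apply the procedure explained in 4.4"; here the blow-up `X'`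
(proper over `k`: Stacks 02NS) is followed by a projective modification `ψ : X'' → X'` (Chow,
`exists_projective_modification`) and `D'` is pulled back along `ψ` (4.10,
`IsEffectiveCartier.comap_of_isDominant`), which avoids the projectivity of `X'`
(`BlowupProjectiveOverField`, needed by `conclusionGenericallyEtale_of_divisor`).
[cite: DeJong1996, 4.8, p. 67] -/
theorem conclusionGenericallyEtale_of_divisor' {k : Type u} [Field k] {X : Scheme.{u}}
    (f : X ⟶ Spec (.of k)) [IsIntegral X] [IsProper f] {Z : Set X} (hZ : IsClosed Z)
    (hZ' : Z ≠ Set.univ)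
    (H : ∀ (X' : Scheme.{u}) (f' : X' ⟶ Spec (.of k)) (Z' : Set X'), IsIntegral X' →
      Literature.AlgebraicGeometry.Motives.IsProjectiveOver (Over.mk f') → IsClosed Z' →
        Z' ≠ Set.univ →
          (∃ D : X'.IdealSheafData, IsEffectiveCartier D ∧ (D.support : Set X') = Z') →
            topologicalKrullDim X' = topologicalKrullDim X → ConclusionGenericallyEtale f' Z') :
    ConclusionGenericallyEtale f Z := by
  haveI : IsLocallyNoetherian X := LocallyOfFiniteType.isLocallyNoetherian f
  -- the ideal sheaf of the reduced closed subscheme `Z`; it is non-zero as `Z ≠ X`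
  let J : X.IdealSheafData := Scheme.IdealSheafData.vanishingIdeal ⟨Z, hZ⟩
  have hJZ : ((J.support : Closeds X) : Set X) = Z := by
    simp [J]
  have hJ : J ≠ ⊥ := by
    intro hJ
    apply hZ'
    rw [← hJZ, hJ, Scheme.IdealSheafData.support_bot]
    rfl
  -- 4.8: blow up `Z`; `φ : X' → X` is a generically étale alteration and `X'` is proper over `k`
  obtain ⟨X', φ, hφ⟩ := exists_isBlowup X J
  have hφalt : IsAlteration φ := isAlteration_of_isBlowup hφ hJ
  haveI : IsIntegral X' := hφalt.isIntegral
  haveI : IsProper φ := hφalt.isProper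
  haveI : Surjective φ := hφalt.surjective
  apply ConclusionGenericallyEtale.of_isAlteration hφalt (isGenericallyEtale_of_isBlowup hφ)
  -- Chow: a projective modification `ψ : X'' → X'` of the proper variety `X'`
  obtain ⟨X'', ψ, hint'', hψ, hψe, hproj''⟩ := exists_projective_modification X' (φ ≫ f)
  haveI := hint''
  haveI := hψ.isProper
  haveI := hψ.isDominant
  haveI : Surjective ψ := hψ.surjective
  apply ConclusionGenericallyEtale.of_isAlteration hψ hψe
  refine H X'' (ψ ≫ φ ≫ f) (ψ ⁻¹' (φ ⁻¹' Z)) inferInstance hproj''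
    ((hZ.preimage φ.continuous).preimage ψ.continuous) ?_
    ⟨(J.comap φ).comap ψ, hφ.isEffectiveCartier.comap_of_isDominant ψ, ?_⟩ ?_
  · -- `ψ⁻¹ φ⁻¹ Z ≠ X''` as `φ`, `ψ` are surjective
    obtain ⟨x, hx⟩ := (Set.ne_univ_iff_exists_notMem Z).mp hZ'
    obtain ⟨x', rfl⟩ := φ.surjective x
    obtain ⟨x'', rfl⟩ := ψ.surjective x'
    exact (Set.ne_univ_iff_exists_notMem _).mpr ⟨x'', hx⟩
  · -- `supp ((I_Z · 𝒪_{X'}) · 𝒪_{X''}) = ψ⁻¹ φ⁻¹ Z`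
    rw [Scheme.IdealSheafData.support_comap, Closeds.coe_preimage,
      Scheme.IdealSheafData.support_comap, Closeds.coe_preimage, hJZ]
  · rw [hψ.topologicalKrullDim_eq (φ ≫ f), hφalt.topologicalKrullDim_eq f]

end DeJong1996

/-! ## `DeJong1996NormalProjectiveReduction` discharged -/

/-- **DISCHARGE of the named fact `DeJong1996NormalProjectiveReduction`** (de Jong 1996,
4.6–4.10, `AlterationsInduction.lean`): over an algebraically closed field, Thm. 4.1 with its
generically-étale clause for a pair `(X, Z)` follows from the same statement for all normal
projective pairs (`DeJong1996.NormalProjectivePair`) of the same dimension. All four printed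
reductions are now proved: 4.6–4.7 Chow's lemma and projective closure
(`DeJong1996.conclusionGenericallyEtale_of_projective`, `AlterationsCompactification.lean`), 4.8
blowing up `Z` — with a second application of Chow's lemma in place of the projectivity of
blow-ups (`DeJong1996.conclusionGenericallyEtale_of_divisor'`) — and 4.10 normalisation
(`DeJong1996NormalizationReduction_holds`, `AlterationsNormalizationReduction.lean`).
[cite: DeJong1996, 4.6–4.10, pp. 66–67] -/
theorem DeJong1996NormalProjectiveReduction_holds : DeJong1996NormalProjectiveReduction.{u} := by
  intro k _ _ X f Z hs hl hq hi hZ hZ' H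
  haveI := hs
  haveI := hl
  haveI := hq
  haveI := hi
  refine DeJong1996.conclusionGenericallyEtale_of_projective f hZ hZ'
    fun X₁ f₁ Z₁ hi₁ hp₁ hZ₁ hZ₁' hd₁ => ?_
  haveI := hi₁
  haveI : IsProper f₁ := hp₁.isProper
  refine DeJong1996.conclusionGenericallyEtale_of_divisor' f₁ hZ₁ hZ₁'
    fun X₂ f₂ Z₂ hi₂ hp₂ hZ₂ hZ₂' hD₂ hd₂ => ?_
  exact DeJong1996NormalizationReduction_holds k X₂ f₂ Z₂ hi₂ hp₂ hZ₂ hZ₂' hD₂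
    fun X₃ f₃ Z₃ hP hd₃ => H X₃ f₃ Z₃ hP (hd₃.trans (hd₂.trans hd₁))

/-! ## The assembly: Thm. 4.1 from 4.11–4.28 and the limit argument of 4.5 -/

/-- **The induction step of Thm. 4.1 from the step for normal projective pairs alone**
(de Jong 1996, 4.11–4.28, `DeJong1996NormalProjectiveStep`), the reductions 4.6–4.10 being
proved. [cite: DeJong1996, 4.6–4.10, pp. 66–67] -/
theorem DeJong1996InductionStep.of_step (hstep : DeJong1996NormalProjectiveStep.{u}) :
    DeJong1996InductionStep.{u} :=
  DeJong1996InductionStep.of_reduction_of_step DeJong1996NormalProjectiveReduction_holds hstep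

/-- **Thm. 4.1 with its generically-étale clause over algebraically closed fields from
4.11–4.28 alone** — 4.3, 4.4, 4.6–4.10 and the induction on `dim X` being proved.
[cite: DeJong1996, 4.3–4.10, pp. 66–67] -/
theorem DeJong1996StrongAlgClosed.of_step (hstep : DeJong1996NormalProjectiveStep.{u}) :
    DeJong1996StrongAlgClosed.{u} :=
  DeJong1996StrongAlgClosed.of_inductionStep (DeJong1996InductionStep.of_step hstep)

/-- Thm. 4.1 (i)+(ii) over every field from 4.5 (`DeJong1996Descent`) and 4.11–4.28.
[cite: DeJong1996, 4.3–4.10, pp. 66–67] -/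
theorem DeJong1996Strong.of_descent_of_step (h45 : DeJong1996Descent.{u})
    (hstep : DeJong1996NormalProjectiveStep.{u}) : DeJong1996Strong.{u} :=
  DeJong1996Strong.of_descent_of_inductionStep h45 (DeJong1996InductionStep.of_step hstep)

/-- The last sentence of Thm. 4.1 (perfect fields) from 4.5 and 4.11–4.28.
[cite: DeJong1996, 4.3–4.10, pp. 66–67] -/
theorem DeJong1996StrongPerfect.of_descent_of_step (h45 : DeJong1996Descent.{u})
    (hstep : DeJong1996NormalProjectiveStep.{u}) : DeJong1996StrongPerfect.{u} :=
  DeJong1996StrongPerfect.of_descent_of_inductionStep h45 (DeJong1996InductionStep.of_step hstep)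

/-- `DeJong1996Projective` (Thm. 4.1 (i)) from 4.5 and 4.11–4.28.
[cite: DeJong1996, Thm. 4.1, p. 66] -/
theorem DeJong1996Projective.of_descent_of_step (h45 : DeJong1996Descent.{u})
    (hstep : DeJong1996NormalProjectiveStep.{u}) : DeJong1996Projective.{u} :=
  (DeJong1996Strong.of_descent_of_step h45 hstep).projective

/-- **Thm. 4.1 (i)+(ii) and its last sentence from the two live nodes of the DAG**: the limit
argument of 4.5 (`DeJong1996.FiniteSubextension45`, `AlterationsDescent.lean`) and the step
4.11–4.28 for normal projective pairs (`DeJong1996NormalProjectiveStep`); everything else in the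
printed proof of Thm. 4.1 (4.3, 4.4, the rest of 4.5, 4.6–4.10, the induction) is proved.
[cite: DeJong1996, 4.3–4.10, pp. 66–67] -/
theorem DeJong1996Strong.of_finiteSubextension45_of_step (H : DeJong1996.FiniteSubextension45.{u})
    (hstep : DeJong1996NormalProjectiveStep.{u}) :
    DeJong1996Strong.{u} ∧ DeJong1996StrongPerfect.{u} :=
  DeJong1996Strong.of_finiteSubextension45_of_inductionStep H (DeJong1996InductionStep.of_step hstep)

/-- **`DeJong1996Projective` (Thm. 4.1 (i)) from the two live nodes** `DeJong1996.FiniteSubextension45`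
(limit argument of 4.5) and `DeJong1996NormalProjectiveStep` (4.11–4.28) — the current trust base
of de Jong's alteration theorem in this topic. [cite: DeJong1996, Thm. 4.1, p. 66] -/
theorem DeJong1996Projective.of_finiteSubextension45_of_step
    (H : DeJong1996.FiniteSubextension45.{u}) (hstep : DeJong1996NormalProjectiveStep.{u}) :
    DeJong1996Projective.{u} :=
  (DeJong1996Strong.of_finiteSubextension45_of_step H hstep).1.projective

end Literature.AlgebraicGeometry.Resolution

end
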